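import Mathlib

/-!
# K1 + K1′ PROVED (card `reshaping-generic`, val-idea-23 g2, ideation (d) REFUTE side of V1 `MatrixDescartes`)

rev 3 (2026-08-28): adds Part D′ — the card's **K1′ `SpreadHankelGeneric`** (`spreadHankelGeneric`,
`K1Check.spreadHankelGeneric_holds`): for `q > 1`, `f` strongly `q`-log-concave (signed form: `f k ≠ 0`,
`q·|f k|·|f (k+2)| ≤ f (k+1)²`), row labels `a : Fin r → ℕ` and column labels `b : Fin c → ℕ` strictly increasing
and `s`-separated, `r ≤ c` and `4·r ≤ q^{s·s}` ⇒ the generalized-Hankel cut `(i, j) ↦ f (a i + b j)` has full row rank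
`r` (gap `s²·log q` per inversion; `θ = q^{−s²/2}`, `2·Σ_{1≤j<r} θ^j < 1` from `θ² ≤ 1/(4r)`).  Hence the typed sector
law `K1Check.TTSectorLaw := ReshapingGeneric ∧ SpreadHankelGeneric` holds (`ttSectorLaw_holds`); Part F proves the support statement
P1 `K1Check.KroneckerDigit` (`kroneckerDigit_holds`, via Mathlib `finFunctionFinEquiv`) — every typed Prop of the sketch is now a theorem.  rev 2: sign-blind K1
(`reshapingGeneric_signed`, critic VERDICT #12 P1).  VP ≠ VNP is not touched by any of this.

`reshapingGeneric` / `K1Check.reshapingGeneric_holds`: for `q ≥ 4` and `f : ℕ → ℝ` strongly `q`-log-concave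
(`f > 0`, `q·f(k)·f(k+2) ≤ f(k+1)²` — Hutchinson's hypothesis at `q = 4`), EVERY base-`P` digit reshaping
`(x, y) ↦ f (P·y + x)` (`x < P`, `y < H`) has full rank `min P H`.  In particular every sequential (tensor-train) cut of
the coefficient tensor of a digit lift `L_f = Σ_e f(Σ e_i B^i) y^e` (theta / q-Pochhammer profiles of the cancellation
door) has full rank `B^{min(t, n-t)}`, so by Nisan's rank bound no ordered ABP / ROABP of width `< B^{⌊n/2⌋}` computes
it — the card's sector law K2 for the ORDERED sector follows (K2's Nisan step is not formalised here).  Nothing here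
bears on VP ≠ VNP; it closes one more digit-lift monster family on the cancellation door of V1.

Proof route (0 sorry): A. geometric row sums + Levy–Desplanques (`det_ne_zero_of_sum_row_lt_diag`);
B. gap-Monge potentials `u, v` turning «row increments grow by ≥ 2L per column» into two-sided decay
`W x i − u x − v i ≤ −L|x−i|`; C. strong log-concavity ⇒ log-ratios drop by `log q` per step ⇒ the log-matrix of any
«increasing rows / 2-spread decreasing columns» minor of `(f (a+b))` is gap-Monge with `L = log q ≥ log 4`;
D. `exp` of the normalised matrix is strictly diagonally dominant ⇒ `det ≠ 0` ⇒ leading `r × r` minor (columns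
reversed) of the reshaping is non-singular ⇒ rank `= min P H` (`Matrix.rank_submatrix_le`, `rank_of_isUnit`).
-/

namespace Summit.ValiantsHypothesis.ValiantsHypothesis.Cruxes.MatrixDescartes.ReshapingGeneric

open Finset Real Matrix

/-! ## A. Geometric off-diagonal sums and diagonal dominance -/

/-- `|k - n|` on naturals, written with truncated subtraction. -/
def ndist (k n : ℕ) : ℕ := (k - n) + (n - k)

lemma ndist_self (k : ℕ) : ndist k k = 0 := by simp [ndist]

lemma ndist_of_lt {k n : ℕ} (h : n < k) : ndist k n = k - n := by
  simp [ndist, Nat.sub_eq_zero_of_le h.le]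

lemma ndist_of_gt {k n : ℕ} (h : k < n) : ndist k n = n - k := by
  simp [ndist, Nat.sub_eq_zero_of_le h.le]

/-- The off-diagonal geometric sum along one row of an `r × r` index set is at most `2θ/(1-θ)`. -/
lemma sum_pow_ndist_le (θ : ℝ) (hθ0 : 0 ≤ θ) (hθ1 : θ < 1) (r k : ℕ) (hk : k < r) :
    ∑ n ∈ (range r).erase k, θ ^ ndist k n ≤ 2 * (θ / (1 - θ)) := by
  have hsplit : (range r).erase k = (range k) ∪ (Ico (k + 1) r) := by
    ext n; simp [Finset.mem_Ico]; omega
  have hdisj : Disjoint (range k) (Ico (k + 1) r) := by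
    rw [Finset.disjoint_left]; intro n hn; simp [Finset.mem_Ico] at hn ⊢; omega
  rw [hsplit, Finset.sum_union hdisj]
  -- left part: n < k, exponent k - n ∈ [1, k]
  have hL : ∑ n ∈ range k, θ ^ ndist k n ≤ θ / (1 - θ) := by
    have h1 : ∑ n ∈ range k, θ ^ ndist k n = ∑ n ∈ range k, θ ^ (k - n) := by
      apply Finset.sum_congr rfl; intro n hn
      rw [ndist_of_lt (Finset.mem_range.mp hn)]
    rw [h1]
    have h2 : ∑ n ∈ range k, θ ^ (k - n) = ∑ j ∈ range k, θ ^ (j + 1) := by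
      rw [← Finset.sum_range_reflect (fun n => θ ^ (k - n)) k]
      apply Finset.sum_congr rfl; intro j hj
      have := Finset.mem_range.mp hj
      congr 1; omega
    rw [h2]
    have h3 : ∑ j ∈ range k, θ ^ (j + 1) = ∑ j ∈ Ico 1 (k + 1), θ ^ j := by
      rw [Finset.sum_Ico_eq_sum_range]; apply Finset.sum_congr (by simp) ; intro j _; ring_nf
    rw [h3]
    calc ∑ j ∈ Ico 1 (k + 1), θ ^ j ≤ θ ^ 1 / (1 - θ) := geom_sum_Ico_le_of_lt_one hθ0 hθ1
      _ = θ / (1 - θ) := by rw [pow_one]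
  -- right part: n > k, exponent n - k ∈ [1, r-k-1]
  have hR : ∑ n ∈ Ico (k + 1) r, θ ^ ndist k n ≤ θ / (1 - θ) := by
    have h1 : ∑ n ∈ Ico (k + 1) r, θ ^ ndist k n = ∑ n ∈ Ico (k + 1) r, θ ^ (n - k) := by
      apply Finset.sum_congr rfl; intro n hn
      rw [ndist_of_gt (by simp [Finset.mem_Ico] at hn; omega)]
    rw [h1]
    have h2 : ∑ n ∈ Ico (k + 1) r, θ ^ (n - k) = ∑ j ∈ Ico 1 (r - k), θ ^ j := by
      rw [Finset.sum_Ico_eq_sum_range, Finset.sum_Ico_eq_sum_range]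
      have : r - k - 1 = r - (k + 1) := by omega
      rw [this]
      apply Finset.sum_congr rfl; intro t _; congr 1; omega
    rw [h2]
    calc ∑ j ∈ Ico 1 (r - k), θ ^ j ≤ θ ^ 1 / (1 - θ) := geom_sum_Ico_le_of_lt_one hθ0 hθ1
      _ = θ / (1 - θ) := by rw [pow_one]
  linarith

/-- **Diagonal dominance after decay (sign-blind).**  If `|N x x| = 1` and `|N x i| ≤ exp (-(log 4)·|x - i|)` off the
diagonal, `N` is strictly diagonally dominant by rows, hence non-singular (Gershgorin / Levy–Desplanques); the signs of the
entries play no role. -/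
theorem det_ne_zero_of_abs_decay {r : ℕ} (N : Matrix (Fin r) (Fin r) ℝ)
    (hdiag : ∀ x, |N x x| = 1)
    (hoff : ∀ x i, x ≠ i → |N x i| ≤ Real.exp (-(Real.log 4) * (ndist x i : ℝ))) :
    N.det ≠ 0 := by
  apply det_ne_zero_of_sum_row_lt_diag
  intro k
  simp only [Real.norm_eq_abs]
  rw [hdiag]
  -- bound each off-diagonal term by (1/4)^ndist
  have hterm : ∀ j ∈ Finset.univ.erase k, |N k j| ≤ (1 / 4 : ℝ) ^ ndist (k : ℕ) (j : ℕ) := by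
    intro j hj
    have hne : k ≠ j := fun h => by simp [h] at hj
    have h1 : |N k j| ≤ Real.exp (-(Real.log 4) * (ndist k j : ℝ)) := hoff k j hne
    have h2 : Real.exp (-(Real.log 4) * (ndist (k : ℕ) (j : ℕ) : ℝ)) = (1 / 4 : ℝ) ^ ndist (k : ℕ) (j : ℕ) := by
      rw [show -(Real.log 4) * (ndist (k:ℕ) (j:ℕ) : ℝ) = (ndist (k:ℕ) (j:ℕ) : ℝ) * Real.log (1/4) by
        rw [one_div, Real.log_inv]; ring]
      rw [Real.exp_nat_mul, Real.exp_log (by norm_num)]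
    exact h1.trans (le_of_eq h2)
  have hsum : ∑ j ∈ Finset.univ.erase k, |N k j|
      ≤ ∑ j ∈ Finset.univ.erase k, (1 / 4 : ℝ) ^ ndist (k : ℕ) (j : ℕ) := Finset.sum_le_sum hterm
  -- transport the sum to `range r`
  have htrans : ∑ j ∈ Finset.univ.erase k, (1 / 4 : ℝ) ^ ndist (k : ℕ) (j : ℕ)
      = ∑ n ∈ (range r).erase (k : ℕ), (1 / 4 : ℝ) ^ ndist (k : ℕ) n := by
    set g : ℕ → ℝ := fun n => if n = (k : ℕ) then 0 else (1 / 4 : ℝ) ^ ndist (k : ℕ) n with hg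
    have hgj : ∀ j : Fin r, j ≠ k → g (j : ℕ) = (1 / 4 : ℝ) ^ ndist (k : ℕ) (j : ℕ) := by
      intro j hj
      have : (j : ℕ) ≠ (k : ℕ) := fun h => hj (Fin.ext h)
      simp [hg, this]
    have hgk : g (k : ℕ) = 0 := by simp [hg]
    calc ∑ j ∈ Finset.univ.erase k, (1 / 4 : ℝ) ^ ndist (k : ℕ) (j : ℕ)
        = ∑ j ∈ Finset.univ.erase k, g (j : ℕ) :=
          Finset.sum_congr rfl (fun j hj => (hgj j (Finset.ne_of_mem_erase hj)).symm)
      _ = ∑ j : Fin r, g (j : ℕ) - g (k : ℕ) := by rw [Finset.sum_erase_eq_sub (Finset.mem_univ k)]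
      _ = ∑ n ∈ range r, g n - g (k : ℕ) := by rw [Fin.sum_univ_eq_sum_range]
      _ = ∑ n ∈ (range r).erase (k : ℕ), g n := by
          rw [Finset.sum_erase_eq_sub (Finset.mem_range.mpr k.isLt)]
      _ = ∑ n ∈ (range r).erase (k : ℕ), (1 / 4 : ℝ) ^ ndist (k : ℕ) n :=
          Finset.sum_congr rfl (fun n hn => by
            have : n ≠ (k : ℕ) := Finset.ne_of_mem_erase hn
            simp [hg, this])
  have hgeo := sum_pow_ndist_le (1 / 4 : ℝ) (by norm_num) (by norm_num) r k k.isLt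
  have : (2 : ℝ) * ((1 / 4) / (1 - 1 / 4)) = 2 / 3 := by norm_num
  linarith [hsum, htrans ▸ hgeo]


/-! ## B. Potentials: increments with a gap in the column index ⇒ two-sided exponential decay -/

/-- Telescoping along the row index. -/
lemma telescope_rows (W : ℕ → ℕ → ℝ) (i x c : ℕ) (hix : i ≤ x) :
    W x c - W i c = ∑ j ∈ Ico i x, (W (j + 1) c - W j c) := by
  rw [Finset.sum_Ico_eq_sum_range]
  have h := Finset.sum_range_sub (fun t => W (i + t) c) (x - i)
  simp only [Nat.add_zero] at h
  rw [show i + (x - i) = x by omega] at h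
  rw [← h]
  apply Finset.sum_congr rfl; intro t _; rw [← add_assoc]

/-- **Gap-Monge potentials.**  If the row increments `W (j+1) i - W j i` grow by at least `2L` per column step
(for indices below `r`), then with `u x = Σ_{j<x} m j` (`m j` the midpoint of the increments of columns `j`, `j+1` at
row step `j`) and `v i = W i i - u i` one has `W x i - u x - v i ≤ -L·|x - i|`, with equality `0` on the diagonal. -/
theorem decay_of_gapMonge (r : ℕ) (W : ℕ → ℕ → ℝ) (L : ℝ) (hL : 0 ≤ L)
    (hW : ∀ j i, j + 1 < r → i + 1 < r → W (j + 1) i - W j i + 2 * L ≤ W (j + 1) (i + 1) - W j (i + 1)) :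
    ∃ u v : ℕ → ℝ, (∀ x, x < r → W x x - u x - v x = 0) ∧
      ∀ x i, x < r → i < r → W x i - u x - v i ≤ -L * (ndist x i : ℝ) := by
  set incr : ℕ → ℕ → ℝ := fun j i => W (j + 1) i - W j i with hincr
  -- monotonicity of the increments in the column index, with gap
  have hmono : ∀ j, j + 1 < r → ∀ i i', i ≤ i' → i' < r → incr j i + 2 * L * (i' - i : ℕ) ≤ incr j i' := by
    intro j hj i i' hii' hi'
    induction i', hii' using Nat.le_induction with
    | base => simp
    | succ n hin ih =>
      have ih' := ih (by omega)
      have hstep := hW j n hj (by omega)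
      have : ((n + 1 - i : ℕ) : ℝ) = (n - i : ℕ) + 1 := by
        rw [show n + 1 - i = (n - i) + 1 by omega]; push_cast; ring
      rw [this]
      simp only [hincr] at ih' hstep ⊢
      nlinarith
  set m : ℕ → ℝ := fun j => (incr j j + incr j (j + 1)) / 2 with hm
  have hm_lo : ∀ j, j + 1 < r → incr j j + L ≤ m j := by
    intro j hj
    have := hW j j hj hj
    simp only [hm, hincr] at this ⊢; linarith
  have hm_hi : ∀ j, j + 1 < r → m j + L ≤ incr j (j + 1) := by
    intro j hj
    have := hW j j hj hj
    simp only [hm, hincr] at this ⊢; linarith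
  set u : ℕ → ℝ := fun x => ∑ j ∈ range x, m j with hu
  set v : ℕ → ℝ := fun i => W i i - u i with hv
  refine ⟨u, v, fun x _ => by simp [hv], ?_⟩
  intro x i hx hi
  have hE : W x i - u x - v i = (W x i - W i i) - (u x - u i) := by simp [hv]; ring
  rw [hE]
  rcases lt_trichotomy i x with hlt | heq | hgt
  · -- below the diagonal: i < x
    have h1 : W x i - W i i = ∑ j ∈ Ico i x, incr j i := telescope_rows W i x i hlt.le
    have h2 : u x - u i = ∑ j ∈ Ico i x, m j := by
      simp only [hu]; rw [Finset.sum_Ico_eq_sub _ hlt.le]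
    rw [h1, h2, ← Finset.sum_sub_distrib]
    have hb : ∀ j ∈ Ico i x, incr j i - m j ≤ -L := by
      intro j hj
      rw [Finset.mem_Ico] at hj
      have hjr : j + 1 < r := by omega
      have := hmono j hjr i j hj.1 (by omega)
      have := hm_lo j hjr
      have : (0 : ℝ) ≤ 2 * L * ((j - i : ℕ) : ℝ) := by positivity
      linarith
    calc ∑ j ∈ Ico i x, (incr j i - m j) ≤ ∑ j ∈ Ico i x, (-L) := Finset.sum_le_sum hb
      _ = -L * (ndist x i : ℝ) := by
        rw [Finset.sum_const, Nat.card_Ico, ndist_of_lt hlt, nsmul_eq_mul]; ring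
  · subst heq; simp [ndist_self]
  · -- above the diagonal: x < i
    have h1 : W x i - W i i = -∑ j ∈ Ico x i, incr j i := by
      have h0 := telescope_rows W x i i hgt.le
      simp only [hincr]
      linarith
    have h2 : u x - u i = -∑ j ∈ Ico x i, m j := by
      simp only [hu]; rw [Finset.sum_Ico_eq_sub _ hgt.le]; ring
    have h3 : W x i - W i i - (u x - u i) = ∑ j ∈ Ico x i, (m j - incr j i) := by
      have hs := Finset.sum_sub_distrib (s := Ico x i) (f := m) (g := fun j => incr j i)
      rw [h1, h2, hs]; ring
    rw [h3]
    have hb : ∀ j ∈ Ico x i, m j - incr j i ≤ -L := by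
      intro j hj
      rw [Finset.mem_Ico] at hj
      have hjr : j + 1 < r := by omega
      have := hmono j hjr (j + 1) i (by omega) hi
      have := hm_hi j hjr
      have : (0 : ℝ) ≤ 2 * L * ((i - (j + 1) : ℕ) : ℝ) := by positivity
      linarith
    calc ∑ j ∈ Ico x i, (m j - incr j i) ≤ ∑ j ∈ Ico x i, (-L) := Finset.sum_le_sum hb
      _ = -L * (ndist x i : ℝ) := by
        rw [Finset.sum_const, Nat.card_Ico, ndist_of_gt hgt, nsmul_eq_mul]; ring


/-! ## C. Strongly log-concave sequences: log-ratios drop by `log q` per step -/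

/-- Log-ratio sequence `D f k = log f (k+1) - log f k`. -/
noncomputable def logRatio (f : ℕ → ℝ) (k : ℕ) : ℝ := Real.log (f (k + 1)) - Real.log (f k)

section LogConcave

variable {q : ℝ} {f : ℕ → ℝ}

lemma logRatio_succ_le (hq : 0 < q) (hne : ∀ k, f k ≠ 0)
    (hlc : ∀ k, q * (|f k| * |f (k + 2)|) ≤ f (k + 1) ^ 2) (k : ℕ) :
    logRatio f (k + 1) + Real.log q ≤ logRatio f k := by
  have hk0 : 0 < |f k| := abs_pos.mpr (hne k)
  have hk2 : 0 < |f (k + 2)| := abs_pos.mpr (hne (k + 2))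
  have hfk : 0 < |f k| * |f (k + 2)| := mul_pos hk0 hk2
  have h := Real.log_le_log (mul_pos hq hfk) (hlc k)
  rw [Real.log_mul hq.ne' hfk.ne', Real.log_mul hk0.ne' hk2.ne', Real.log_abs, Real.log_abs, Real.log_pow] at h
  simp only [logRatio]
  push_cast at h
  linarith

lemma logRatio_add_le (hq : 0 < q) (hne : ∀ k, f k ≠ 0)
    (hlc : ∀ k, q * (|f k| * |f (k + 2)|) ≤ f (k + 1) ^ 2) (k t : ℕ) :
    logRatio f (k + t) + t * Real.log q ≤ logRatio f k := by
  induction t with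
  | zero => simp
  | succ t ih =>
    have := logRatio_succ_le hq hne hlc (k + t)
    rw [show k + (t + 1) = k + t + 1 by ring]
    push_cast
    linarith

lemma log_telescope (f : ℕ → ℝ) (k t : ℕ) :
    Real.log (f (k + t)) - Real.log (f k) = ∑ s ∈ range t, logRatio f (k + s) := by
  have h := Finset.sum_range_sub (fun s => Real.log (f (k + s))) t
  simp only [Nat.add_zero] at h
  rw [← h]
  apply Finset.sum_congr rfl; intro s _; simp only [logRatio]; rw [← add_assoc]

/-- **Gap-Monge increments.**  With `W x i = log f (a x + b i)`, `a` increasing and `b` decreasing with steps `≥ 2`,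
the row increments grow by at least `2 log q` per column step. -/
lemma incr_gap (hq : 1 ≤ q) (hne : ∀ k, f k ≠ 0)
    (hlc : ∀ k, q * (|f k| * |f (k + 2)|) ≤ f (k + 1) ^ 2) (a b : ℕ → ℕ) (j i : ℕ)
    (ha : a j < a (j + 1)) (hb : b (i + 1) + 2 ≤ b i) :
    (Real.log (f (a (j + 1) + b i)) - Real.log (f (a j + b i))) + 2 * Real.log q
      ≤ Real.log (f (a (j + 1) + b (i + 1))) - Real.log (f (a j + b (i + 1))) := by
  have hq0 : 0 < q := by linarith
  have hlq : 0 ≤ Real.log q := Real.log_nonneg hq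
  set n := a (j + 1) - a j with hn
  have hn1 : 1 ≤ n := by omega
  set g := b i - b (i + 1) with hg
  have hg2 : 2 ≤ g := by omega
  have e1 : a (j + 1) + b i = (a j + b i) + n := by omega
  have e2 : a (j + 1) + b (i + 1) = (a j + b (i + 1)) + n := by omega
  rw [e1, e2, log_telescope f (a j + b i) n, log_telescope f (a j + b (i + 1)) n]
  -- termwise comparison with gap `g log q ≥ 2 log q`
  have hterm : ∀ s ∈ range n, logRatio f (a j + b i + s) + 2 * Real.log q ≤ logRatio f (a j + b (i + 1) + s) := by
    intro s _
    have h := logRatio_add_le hq0 hne hlc (a j + b (i + 1) + s) g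
    have e3 : a j + b (i + 1) + s + g = a j + b i + s := by omega
    rw [e3] at h
    have : (2 : ℝ) * Real.log q ≤ (g : ℝ) * Real.log q := by
      have : (2 : ℝ) ≤ (g : ℝ) := by exact_mod_cast hg2
      nlinarith
    linarith
  have hsum := Finset.sum_le_sum hterm
  rw [Finset.sum_add_distrib, Finset.sum_const, Finset.card_range, nsmul_eq_mul] at hsum
  have : (2 : ℝ) * Real.log q ≤ (n : ℝ) * (2 * Real.log q) := by
    have : (1 : ℝ) ≤ (n : ℝ) := by exact_mod_cast hn1
    nlinarith
  linarith

/-! ## D. The theorem: every square «increasing rows / 2-spread decreasing columns» minor of `(f (a + b))`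
is non-singular; hence every digit reshaping of a strongly log-concave sequence has full rank. -/

/-- **K1 core.**  For `q ≥ 4` and `f` strongly `q`-log-concave (`q·f(k)·f(k+2) ≤ f(k+1)²`, `f > 0`), the matrix
`(x, i) ↦ f (a x + b i)` with `a` strictly increasing and `b` strictly decreasing with steps `≥ 2` has non-zero
determinant. -/
theorem det_logConcaveMinor_ne_zero (hq : 4 ≤ q) (hne : ∀ k, f k ≠ 0)
    (hlc : ∀ k, q * (|f k| * |f (k + 2)|) ≤ f (k + 1) ^ 2) {r : ℕ} (a b : ℕ → ℕ)
    (ha : ∀ j, j + 1 < r → a j < a (j + 1)) (hb : ∀ i, i + 1 < r → b (i + 1) + 2 ≤ b i) :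
    (Matrix.of fun x i : Fin r => f (a x + b i)).det ≠ 0 := by
  have hq1 : (1 : ℝ) ≤ q := by linarith
  have hlq : Real.log 4 ≤ Real.log q := Real.log_le_log (by norm_num) hq
  have hlq0 : 0 ≤ Real.log q := Real.log_nonneg hq1
  set W : ℕ → ℕ → ℝ := fun x i => Real.log (f (a x + b i)) with hW
  have hgap : ∀ j i, j + 1 < r → i + 1 < r →
      W (j + 1) i - W j i + 2 * Real.log q ≤ W (j + 1) (i + 1) - W j (i + 1) := by
    intro j i hj hi
    simpa [hW] using incr_gap hq1 hne hlc a b j i (ha j hj) (hb i hi)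
  obtain ⟨u, v, hdiag, hoff⟩ := decay_of_gapMonge r W (Real.log q) hlq0 hgap
  -- the normalised matrix `N = diag(e^{-u}) · A · diag(e^{-v})`, `|N x i| = exp (W x i - u x - v i)`
  set A : Matrix (Fin r) (Fin r) ℝ := Matrix.of fun x i : Fin r => f (a x + b i) with hAdef
  set N : Matrix (Fin r) (Fin r) ℝ := Matrix.of fun x i : Fin r => Real.exp (-u x) *
      ((Matrix.of fun x i : Fin r => Real.exp (-v i) * A x i) x i) with hNdef
  have hN : ∀ x i : Fin r, |N x i| = Real.exp (W x i - u x - v i) := by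
    intro x i
    simp only [hNdef, hAdef, Matrix.of_apply, abs_mul, abs_of_pos (Real.exp_pos _)]
    rw [← Real.exp_log_eq_abs (hne _),
      show W x i - u x - v i = -u x + (-v i + Real.log (f (a x + b i))) by simp only [hW]; ring,
      Real.exp_add, Real.exp_add]
  have hA : N.det ≠ 0 := det_ne_zero_of_abs_decay N
    (fun x => by rw [hN, hdiag x x.isLt, Real.exp_zero])
    (by
      intro x i hxi
      rw [hN]
      apply Real.exp_le_exp.mpr
      have h := hoff x i x.isLt i.isLt
      have : -(Real.log q) * (ndist x i : ℝ) ≤ -(Real.log 4) * (ndist x i : ℝ) := by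
        have : (0 : ℝ) ≤ (ndist x i : ℝ) := by positivity
        nlinarith
      exact h.trans this)
  rw [hNdef, Matrix.det_mul_column, Matrix.det_mul_row] at hA
  intro h0
  apply hA
  rw [h0]; ring

/-- **K1, signed form (full-rank reshapings; critic price P1 of VERDICT #12).**  Every base-`P` digit reshaping
`(x, y) ↦ f (P·y + x)` (`x < P`, `y < H`) of a nowhere-zero sequence with `q·|f(k)|·|f(k+2)| ≤ f(k+1)²`, `q ≥ 4` (signs
ARBITRARY), has rank `min P H`. -/
theorem reshapingGeneric_signed : ∀ q : ℝ, 4 ≤ q → ∀ f : ℕ → ℝ,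
    ((∀ k, f k ≠ 0) ∧ ∀ k, q * (|f k| * |f (k + 2)|) ≤ f (k + 1) ^ 2) →
    ∀ P H : ℕ, (Matrix.of fun (x : Fin P) (y : Fin H) => f (P * (y : ℕ) + (x : ℕ))).rank = min P H := by
  intro q hq f hf P H
  set M : Matrix (Fin P) (Fin H) ℝ := Matrix.of fun (x : Fin P) (y : Fin H) => f (P * (y : ℕ) + (x : ℕ)) with hM
  apply le_antisymm
  · exact le_min (Matrix.rank_le_height M) (Matrix.rank_le_width M)
  · set r := min P H with hr
    have hrP : r ≤ P := min_le_left _ _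
    have hrH : r ≤ H := min_le_right _ _
    rcases Nat.lt_or_ge P 2 with hP | hP
    · -- `P ≤ 1`: rank ≥ min P H is `0` or a non-zero `1 × H` row
      interval_cases P
      · simp [hr]
      · -- P = 1
        rcases Nat.eq_zero_or_pos H with hH | hH
        · subst hH; simp [hr]
        · have h1 : r = 1 := by rw [hr]; exact Nat.min_eq_left (by omega)
          rw [h1]
          -- the `1 × 1` minor at column 0 is `f 0... ` non-zero
          let S : Matrix (Fin 1) (Fin 1) ℝ := M.submatrix (Fin.castLE (le_refl 1)) (Fin.castLE (by omega : 1 ≤ H))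
          have hS : S.det ≠ 0 := by
            rw [Matrix.det_fin_one]
            simp only [S, Matrix.submatrix_apply, hM, Matrix.of_apply]
            exact hf.1 _
          have hSr : S.rank = 1 := by
            have := Matrix.rank_of_isUnit S ((Matrix.isUnit_iff_isUnit_det S).mpr (isUnit_iff_ne_zero.mpr hS))
            simpa using this
          calc 1 = S.rank := hSr.symm
            _ ≤ M.rank := Matrix.rank_submatrix_le M _ _
    · -- `P ≥ 2`: the leading `r × r` minor with reversed columns is a gap-Monge minor
      let S : Matrix (Fin r) (Fin r) ℝ :=
        M.submatrix (Fin.castLE hrP) (fun j => Fin.castLE hrH (Fin.rev j))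
      have hSeq : S = Matrix.of fun x i : Fin r => f ((fun n => n) x + (fun n => P * (r - 1 - n)) i) := by
        ext x i
        simp only [S, Matrix.submatrix_apply, hM, Matrix.of_apply, Fin.val_castLE, Fin.val_rev]
        congr 1
        rw [show r - (i + 1) = r - 1 - i by omega]; ring
      have hS : S.det ≠ 0 := by
        rw [hSeq]
        exact det_logConcaveMinor_ne_zero hq hf.1 hf.2 (fun n => n) (fun n => P * (r - 1 - n))
          (fun j _ => by omega) (fun i hi => by
            show P * (r - 1 - (i + 1)) + 2 ≤ P * (r - 1 - i)
            have : r - 1 - i = (r - 1 - (i + 1)) + 1 := by omega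
            rw [this, Nat.mul_add]; omega)
      have hSr : S.rank = r := by
        have := Matrix.rank_of_isUnit S ((Matrix.isUnit_iff_isUnit_det S).mpr (isUnit_iff_ne_zero.mpr hS))
        simpa using this
      calc r = S.rank := hSr.symm
        _ ≤ M.rank := Matrix.rank_submatrix_le M _ _

/-! ## D′. Spread Hankel cuts (the card's K1′): `s`-separated labels, margin `q > 1`, `4r ≤ q^{s²}` -/

/-- Finite form of the off-diagonal geometric row sum: `≤ 2·Σ_{1 ≤ j < r} θ^j`. -/
lemma sum_pow_ndist_le_finite (θ : ℝ) (hθ0 : 0 ≤ θ) (r k : ℕ) (hk : k < r) :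
    ∑ n ∈ (range r).erase k, θ ^ ndist k n ≤ 2 * ∑ j ∈ Ico 1 r, θ ^ j := by
  have hsplit : (range r).erase k = (range k) ∪ (Ico (k + 1) r) := by
    ext n; simp [Finset.mem_Ico]; omega
  have hdisj : Disjoint (range k) (Ico (k + 1) r) := by
    rw [Finset.disjoint_left]; intro n hn; simp [Finset.mem_Ico] at hn ⊢; omega
  rw [hsplit, Finset.sum_union hdisj]
  have hnn : ∀ j ∈ Ico 1 r, j ∉ (∅ : Finset ℕ) → (0 : ℝ) ≤ θ ^ j := fun j _ _ => pow_nonneg hθ0 j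
  have hL : ∑ n ∈ range k, θ ^ ndist k n ≤ ∑ j ∈ Ico 1 r, θ ^ j := by
    have h1 : ∑ n ∈ range k, θ ^ ndist k n = ∑ n ∈ range k, θ ^ (k - n) := by
      apply Finset.sum_congr rfl; intro n hn
      rw [ndist_of_lt (Finset.mem_range.mp hn)]
    have h2 : ∑ n ∈ range k, θ ^ (k - n) = ∑ j ∈ range k, θ ^ (j + 1) := by
      rw [← Finset.sum_range_reflect (fun n => θ ^ (k - n)) k]
      apply Finset.sum_congr rfl; intro j hj
      have := Finset.mem_range.mp hj
      congr 1; omega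
    have h3 : ∑ j ∈ range k, θ ^ (j + 1) = ∑ j ∈ Ico 1 (k + 1), θ ^ j := by
      rw [Finset.sum_Ico_eq_sum_range]; apply Finset.sum_congr (by simp) ; intro j _; ring_nf
    rw [h1, h2, h3]
    apply Finset.sum_le_sum_of_subset_of_nonneg (Finset.Ico_subset_Ico_right (by omega))
    intro j _ _; exact pow_nonneg hθ0 j
  have hR : ∑ n ∈ Ico (k + 1) r, θ ^ ndist k n ≤ ∑ j ∈ Ico 1 r, θ ^ j := by
    have h1 : ∑ n ∈ Ico (k + 1) r, θ ^ ndist k n = ∑ n ∈ Ico (k + 1) r, θ ^ (n - k) := by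
      apply Finset.sum_congr rfl; intro n hn
      rw [ndist_of_gt (by simp [Finset.mem_Ico] at hn; omega)]
    have h2 : ∑ n ∈ Ico (k + 1) r, θ ^ (n - k) = ∑ j ∈ Ico 1 (r - k), θ ^ j := by
      rw [Finset.sum_Ico_eq_sum_range, Finset.sum_Ico_eq_sum_range]
      have : r - k - 1 = r - (k + 1) := by omega
      rw [this]
      apply Finset.sum_congr rfl; intro t _; congr 1; omega
    rw [h1, h2]
    apply Finset.sum_le_sum_of_subset_of_nonneg (Finset.Ico_subset_Ico_right (by omega))
    intro j _ _; exact pow_nonneg hθ0 j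
  linarith

/-- Diagonal dominance after decay, finite-sum form: `|N x x| = 1`, `|N x i| ≤ θ^{|x−i|}`, `2·Σ_{1≤j<r} θ^j < 1` ⇒ `det N ≠ 0`. -/
theorem det_ne_zero_of_abs_decay' {r : ℕ} (N : Matrix (Fin r) (Fin r) ℝ) (θ : ℝ) (hθ0 : 0 ≤ θ)
    (hrow : 2 * ∑ j ∈ Ico 1 r, θ ^ j < 1)
    (hdiag : ∀ x, |N x x| = 1)
    (hoff : ∀ x i, x ≠ i → |N x i| ≤ θ ^ ndist x i) :
    N.det ≠ 0 := by
  apply det_ne_zero_of_sum_row_lt_diag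
  intro k
  simp only [Real.norm_eq_abs]
  rw [hdiag]
  have hterm : ∀ j ∈ Finset.univ.erase k, |N k j| ≤ θ ^ ndist (k : ℕ) (j : ℕ) := by
    intro j hj
    have hne : k ≠ j := fun h => by simp [h] at hj
    exact hoff k j hne
  have hsum : ∑ j ∈ Finset.univ.erase k, |N k j|
      ≤ ∑ j ∈ Finset.univ.erase k, θ ^ ndist (k : ℕ) (j : ℕ) := Finset.sum_le_sum hterm
  have htrans : ∑ j ∈ Finset.univ.erase k, θ ^ ndist (k : ℕ) (j : ℕ)
      = ∑ n ∈ (range r).erase (k : ℕ), θ ^ ndist (k : ℕ) n := by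
    set g : ℕ → ℝ := fun n => if n = (k : ℕ) then 0 else θ ^ ndist (k : ℕ) n with hg
    have hgj : ∀ j : Fin r, j ≠ k → g (j : ℕ) = θ ^ ndist (k : ℕ) (j : ℕ) := by
      intro j hj
      have : (j : ℕ) ≠ (k : ℕ) := fun h => hj (Fin.ext h)
      simp [hg, this]
    calc ∑ j ∈ Finset.univ.erase k, θ ^ ndist (k : ℕ) (j : ℕ)
        = ∑ j ∈ Finset.univ.erase k, g (j : ℕ) :=
          Finset.sum_congr rfl (fun j hj => (hgj j (Finset.ne_of_mem_erase hj)).symm)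
      _ = ∑ j : Fin r, g (j : ℕ) - g (k : ℕ) := by rw [Finset.sum_erase_eq_sub (Finset.mem_univ k)]
      _ = ∑ n ∈ range r, g n - g (k : ℕ) := by rw [Fin.sum_univ_eq_sum_range]
      _ = ∑ n ∈ (range r).erase (k : ℕ), g n := by
          rw [Finset.sum_erase_eq_sub (Finset.mem_range.mpr k.isLt)]
      _ = ∑ n ∈ (range r).erase (k : ℕ), θ ^ ndist (k : ℕ) n :=
          Finset.sum_congr rfl (fun n hn => by
            have : n ≠ (k : ℕ) := Finset.ne_of_mem_erase hn
            simp [hg, this])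
  have hgeo := sum_pow_ndist_le_finite θ hθ0 r k k.isLt
  linarith [hsum, htrans ▸ hgeo]

/-- Gap-Monge increments with spreads: row steps `≥ sa` (and `≥ 1`), column steps `≥ sb` ⇒ increment gap `≥ sa·sb·log q`. -/
lemma incr_gap' (hq : 1 ≤ q) (hne : ∀ k, f k ≠ 0)
    (hlc : ∀ k, q * (|f k| * |f (k + 2)|) ≤ f (k + 1) ^ 2) (sa sb : ℕ) (a b : ℕ → ℕ) (j i : ℕ)
    (ha : a j < a (j + 1)) (hsa : a j + sa ≤ a (j + 1)) (hsb : b (i + 1) + sb ≤ b i) :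
    (Real.log (f (a (j + 1) + b i)) - Real.log (f (a j + b i))) + ((sa * sb : ℕ) : ℝ) * Real.log q
      ≤ Real.log (f (a (j + 1) + b (i + 1))) - Real.log (f (a j + b (i + 1))) := by
  have hq0 : 0 < q := by linarith
  have hlq : 0 ≤ Real.log q := Real.log_nonneg hq
  set n := a (j + 1) - a j with hn
  have hn1 : sa ≤ n := by omega
  set g := b i - b (i + 1) with hg
  have hg2 : sb ≤ g := by omega
  have e1 : a (j + 1) + b i = (a j + b i) + n := by omega
  have e2 : a (j + 1) + b (i + 1) = (a j + b (i + 1)) + n := by omega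
  rw [e1, e2, log_telescope f (a j + b i) n, log_telescope f (a j + b (i + 1)) n]
  have hterm : ∀ s ∈ range n, logRatio f (a j + b i + s) + (sb : ℝ) * Real.log q
      ≤ logRatio f (a j + b (i + 1) + s) := by
    intro s _
    have h := logRatio_add_le hq0 hne hlc (a j + b (i + 1) + s) g
    have e3 : a j + b (i + 1) + s + g = a j + b i + s := by omega
    rw [e3] at h
    have : (sb : ℝ) * Real.log q ≤ (g : ℝ) * Real.log q := by
      have : (sb : ℝ) ≤ (g : ℝ) := by exact_mod_cast hg2
      nlinarith
    linarith
  have hsum := Finset.sum_le_sum hterm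
  rw [Finset.sum_add_distrib, Finset.sum_const, Finset.card_range, nsmul_eq_mul] at hsum
  have : ((sa * sb : ℕ) : ℝ) * Real.log q ≤ (n : ℝ) * ((sb : ℝ) * Real.log q) := by
    have h1 : (sa : ℝ) ≤ (n : ℝ) := by exact_mod_cast hn1
    have h2 : (0 : ℝ) ≤ (sb : ℝ) * Real.log q := by positivity
    push_cast
    nlinarith
  linarith

/-- **K1′ core.**  `f` nowhere zero with margin `q ≥ 1`, rows increasing with steps `≥ sa`, columns decreasing with steps
`≥ sb`, and `θ = exp(−sa·sb·log q / 2)` small enough that `2·Σ_{1≤j<r} θ^j < 1` ⇒ the `r × r` matrix `f (a x + b i)` is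
non-singular. -/
theorem det_hankelMinor_ne_zero (hq : 1 ≤ q) (hne : ∀ k, f k ≠ 0)
    (hlc : ∀ k, q * (|f k| * |f (k + 2)|) ≤ f (k + 1) ^ 2) {r : ℕ} (sa sb : ℕ) (a b : ℕ → ℕ)
    (ha : ∀ j, j + 1 < r → a j < a (j + 1)) (hsa : ∀ j, j + 1 < r → a j + sa ≤ a (j + 1))
    (hsb : ∀ i, i + 1 < r → b (i + 1) + sb ≤ b i)
    (hrow : 2 * ∑ j ∈ Ico 1 r, (Real.exp (-(((sa * sb : ℕ) : ℝ) * Real.log q / 2))) ^ j < 1) :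
    (Matrix.of fun x i : Fin r => f (a x + b i)).det ≠ 0 := by
  have hlq0 : 0 ≤ Real.log q := Real.log_nonneg hq
  set L : ℝ := ((sa * sb : ℕ) : ℝ) * Real.log q / 2 with hL
  have hL0 : 0 ≤ L := by positivity
  set θ : ℝ := Real.exp (-L) with hθ
  set W : ℕ → ℕ → ℝ := fun x i => Real.log (f (a x + b i)) with hW
  have hgap : ∀ j i, j + 1 < r → i + 1 < r →
      W (j + 1) i - W j i + 2 * L ≤ W (j + 1) (i + 1) - W j (i + 1) := by
    intro j i hj hi
    have := incr_gap' hq hne hlc sa sb a b j i (ha j hj) (hsa j hj) (hsb i hi)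
    simp only [hW, hL]
    linarith
  obtain ⟨u, v, hdiag, hoff⟩ := decay_of_gapMonge r W L hL0 hgap
  set A : Matrix (Fin r) (Fin r) ℝ := Matrix.of fun x i : Fin r => f (a x + b i) with hAdef
  set N : Matrix (Fin r) (Fin r) ℝ := Matrix.of fun x i : Fin r => Real.exp (-u x) *
      ((Matrix.of fun x i : Fin r => Real.exp (-v i) * A x i) x i) with hNdef
  have hN : ∀ x i : Fin r, |N x i| = Real.exp (W x i - u x - v i) := by
    intro x i
    simp only [hNdef, hAdef, Matrix.of_apply, abs_mul, abs_of_pos (Real.exp_pos _)]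
    rw [← Real.exp_log_eq_abs (hne _),
      show W x i - u x - v i = -u x + (-v i + Real.log (f (a x + b i))) by simp only [hW]; ring,
      Real.exp_add, Real.exp_add]
  have hA : N.det ≠ 0 := det_ne_zero_of_abs_decay' N θ (Real.exp_pos _).le hrow
    (fun x => by rw [hN, hdiag x x.isLt, Real.exp_zero])
    (by
      intro x i hxi
      rw [hN, hθ, ← Real.exp_nat_mul]
      apply Real.exp_le_exp.mpr
      have h := hoff x i x.isLt i.isLt
      linarith)
  rw [hNdef, Matrix.det_mul_column, Matrix.det_mul_row] at hA
  intro h0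
  apply hA
  rw [h0]; ring

/-- The numerical side condition of K1′: `4r ≤ q^{s²}` (`q > 1`) makes `2·Σ_{1≤j<r} θ^j < 1` for `θ = q^{−s²/2}`. -/
lemma hrow_of_spread {q : ℝ} (hq : 1 < q) (r s : ℕ) (hr : (4 * r : ℝ) ≤ q ^ (s * s)) :
    2 * ∑ j ∈ Ico 1 r, (Real.exp (-(((s * s : ℕ) : ℝ) * Real.log q / 2))) ^ j < 1 := by
  have hq0 : 0 < q := by linarith
  set θ := Real.exp (-(((s * s : ℕ) : ℝ) * Real.log q / 2)) with hθ
  have hθ0 : 0 < θ := Real.exp_pos _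
  have hθsq : θ ^ 2 = (q ^ (s * s))⁻¹ := by
    rw [sq, hθ, ← Real.exp_add,
      show -(((s * s : ℕ) : ℝ) * Real.log q / 2) + -(((s * s : ℕ) : ℝ) * Real.log q / 2)
        = -(((s * s : ℕ) : ℝ) * Real.log q) by ring,
      Real.exp_neg, ← Real.log_pow, Real.exp_log (by positivity)]
  rcases Nat.lt_or_ge r 3 with hr3 | hr3
  · interval_cases r
    · simp
    · simp
    · -- r = 2 : the sum is `θ`, and `θ² ≤ 1/8 < 1/4`
      have hs : ∑ j ∈ Ico 1 2, θ ^ j = θ := by simp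
      rw [hs]
      have h8 : θ ^ 2 ≤ 1 / 8 := by
        rw [hθsq, inv_eq_one_div]
        apply one_div_le_one_div_of_le (by norm_num)
        push_cast at hr; linarith
      nlinarith
  · -- r ≥ 3 : `θ² ≤ 1/12 < 1/9`, so `θ < 1/3` and the infinite geometric bound suffices
    have h12 : θ ^ 2 ≤ 1 / 12 := by
      rw [hθsq, inv_eq_one_div]
      apply one_div_le_one_div_of_le (by norm_num)
      have : (12 : ℝ) ≤ 4 * r := by
        have : (3 : ℝ) ≤ r := by exact_mod_cast hr3
        linarith
      linarith
    have hθ3 : θ < 1 / 3 := by nlinarith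
    have hθ1 : θ < 1 := by linarith
    have hgeo : ∑ j ∈ Ico 1 r, θ ^ j ≤ θ ^ 1 / (1 - θ) := geom_sum_Ico_le_of_lt_one hθ0.le hθ1
    rw [pow_one] at hgeo
    have h13 : θ / (1 - θ) < 1 / 2 := by
      rw [div_lt_iff₀ (by linarith)]; linarith
    linarith

/-- **K1′, signed form (spread Hankel cuts have full row rank).**  With `q > 1`, `f` nowhere zero with
`q·|f k|·|f (k+2)| ≤ f (k+1)²`, row labels `a` and column labels `b` strictly increasing and `s`-separated, `r ≤ c` and
`4r ≤ q^{s²}`, the `r × c` matrix `f (a i + b j)` has rank `r`. -/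
theorem spreadHankelGeneric_signed : ∀ q : ℝ, 1 < q → ∀ f : ℕ → ℝ,
    ((∀ k, f k ≠ 0) ∧ ∀ k, q * (|f k| * |f (k + 2)|) ≤ f (k + 1) ^ 2) →
    ∀ (r c s : ℕ) (a : Fin r → ℕ) (b : Fin c → ℕ), r ≤ c → StrictMono a → StrictMono b →
      (∀ i j : Fin r, i < j → a i + s ≤ a j) → (∀ i j : Fin c, i < j → b i + s ≤ b j) →
      (4 * r : ℝ) ≤ q ^ (s * s) →
      (Matrix.of fun (i : Fin r) (j : Fin c) => f (a i + b j)).rank = r := by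
  intro q hq f hf r c s a b hrc ha hb has hbs hr
  set M : Matrix (Fin r) (Fin c) ℝ := Matrix.of fun (i : Fin r) (j : Fin c) => f (a i + b j) with hM
  apply le_antisymm (Matrix.rank_le_height M)
  -- the `r × r` minor on the first `r` columns, columns reversed
  let a' : ℕ → ℕ := fun n => if h : n < r then a ⟨n, h⟩ else 0
  let b' : ℕ → ℕ := fun n => if h : n < r then b (Fin.castLE hrc (Fin.rev ⟨n, h⟩)) else 0
  let S : Matrix (Fin r) (Fin r) ℝ := M.submatrix id (fun j => Fin.castLE hrc (Fin.rev j))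
  have hSeq : S = Matrix.of fun x i : Fin r => f (a' x + b' i) := by
    ext x i
    simp [S, hM, Matrix.submatrix_apply, a', b']
  have hS : S.det ≠ 0 := by
    rw [hSeq]
    refine det_hankelMinor_ne_zero hq.le hf.1 hf.2 s s a' b' ?_ ?_ ?_ (hrow_of_spread hq r s hr)
    · intro j hj
      have h1 : j < r := by omega
      simp only [a', dif_pos h1, dif_pos hj]
      exact ha (by simp [Fin.lt_def])
    · intro j hj
      have h1 : j < r := by omega
      simp only [a', dif_pos h1, dif_pos hj]
      exact has _ _ (by simp [Fin.lt_def])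
    · intro i hi
      have h1 : i < r := by omega
      simp only [b', dif_pos h1, dif_pos hi]
      exact hbs _ _ (by simp [Fin.lt_def, Fin.val_rev]; omega)
  have hSr : S.rank = r := by
    have := Matrix.rank_of_isUnit S ((Matrix.isUnit_iff_isUnit_det S).mpr (isUnit_iff_ne_zero.mpr hS))
    simpa using this
  calc r = S.rank := hSr.symm
    _ ≤ M.rank := Matrix.rank_submatrix_le M _ _

/-- **K1′ (positive form, as typed on the card: `SpreadHankelGeneric`).** -/
theorem spreadHankelGeneric : ∀ q : ℝ, 1 < q → ∀ f : ℕ → ℝ,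
    ((∀ k, 0 < f k) ∧ ∀ k, q * (f k * f (k + 2)) ≤ f (k + 1) ^ 2) →
    ∀ (r c s : ℕ) (a : Fin r → ℕ) (b : Fin c → ℕ), r ≤ c → StrictMono a → StrictMono b →
      (∀ i j : Fin r, i < j → a i + s ≤ a j) → (∀ i j : Fin c, i < j → b i + s ≤ b j) →
      (4 * r : ℝ) ≤ q ^ (s * s) →
      (Matrix.of fun (i : Fin r) (j : Fin c) => f (a i + b j)).rank = r := by
  intro q hq f hf
  refine spreadHankelGeneric_signed q hq f ⟨fun k => (hf.1 k).ne', fun k => ?_⟩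
  rw [abs_of_pos (hf.1 k), abs_of_pos (hf.1 (k + 2))]
  exact hf.2 k

end LogConcave


/-- **K1 (positive form, as typed on the card).**  This is literally the statement `ReshapingGeneric` of
`ReshapingGenericSketch.lean` with `IsStrongLogConcave` and `reshape` unfolded. -/
theorem reshapingGeneric : ∀ q : ℝ, 4 ≤ q → ∀ f : ℕ → ℝ,
    ((∀ k, 0 < f k) ∧ ∀ k, q * (f k * f (k + 2)) ≤ f (k + 1) ^ 2) →
    ∀ P H : ℕ, (Matrix.of fun (x : Fin P) (y : Fin H) => f (P * (y : ℕ) + (x : ℕ))).rank = min P H := by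
  intro q hq f hf P H
  refine reshapingGeneric_signed q hq f ⟨fun k => (hf.1 k).ne', fun k => ?_⟩ P H
  rw [abs_of_pos (hf.1 k), abs_of_pos (hf.1 (k + 2))]
  exact hf.2 k

/-! ## F. Kronecker substitution of a digit lift (the card's support statement P1 `KroneckerDigit`) -/

section Kronecker
open Polynomial

/-- `aeval (y_i ↦ X^{c·B^i})` sends the digit lift `Σ_e f(Σ e_i B^i)·Π y_i^{e_i}` to the lacunary one-variable polynomial
`Σ_{k < B^n} f k · X^{c·k}` (base-`B` digits are a bijection `(Fin n → Fin B) ≃ Fin (B^n)`, Mathlib `finFunctionFinEquiv`).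
Holds for every `B` (the card's `2 ≤ B` is not needed). -/
theorem kroneckerDigit_core (B n c : ℕ) (f : ℕ → ℝ) :
    MvPolynomial.aeval (fun i : Fin n => (X : ℝ[X]) ^ (c * B ^ (i : ℕ)))
        (∑ e : Fin n → Fin B, MvPolynomial.C (f (∑ i, (e i : ℕ) * B ^ (i : ℕ))) * ∏ i, MvPolynomial.X i ^ (e i : ℕ))
      = ∑ k ∈ Finset.range (B ^ n), Polynomial.C (f k) * X ^ (c * k) := by
  rw [map_sum]
  have hterm : ∀ e : Fin n → Fin B,
      MvPolynomial.aeval (fun i : Fin n => (X : ℝ[X]) ^ (c * B ^ (i : ℕ)))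
        (MvPolynomial.C (f (∑ i, (e i : ℕ) * B ^ (i : ℕ))) * ∏ i, MvPolynomial.X i ^ (e i : ℕ))
      = Polynomial.C (f (∑ i, (e i : ℕ) * B ^ (i : ℕ))) * X ^ (c * ∑ i, (e i : ℕ) * B ^ (i : ℕ)) := by
    intro e
    rw [map_mul, MvPolynomial.aeval_C, map_prod, Polynomial.algebraMap_eq]
    congr 1
    simp only [map_pow, MvPolynomial.aeval_X, ← pow_mul]
    rw [Finset.prod_pow_eq_pow_sum, Finset.mul_sum]
    congr 1
    apply Finset.sum_congr rfl
    intro i _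
    ring
  simp only [hterm]
  rw [← Fin.sum_univ_eq_sum_range (fun k => Polynomial.C (f k) * X ^ (c * k)) (B ^ n)]
  rw [← Equiv.sum_comp finFunctionFinEquiv]
  apply Fintype.sum_congr
  intro e
  simp

end Kronecker

/-! ## E. Kernel cross-check against the card's typed K1

`ReshapingGenericSketch.lean` (crux workfile @7d6b33672665) is not importable from a workfile check, so its two
definitions and the Prop `ReshapingGeneric` are copied VERBATIM into the sub-namespace `K1Check`; the one-line proof
below confirms that `reshapingGeneric` is literally the card's K1. -/

namespace K1Check

/-- verbatim copy of `IsStrongLogConcave` (ReshapingGenericSketch.lean). -/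
def IsStrongLogConcave (q : ℝ) (f : ℕ → ℝ) : Prop :=
  (∀ k, 0 < f k) ∧ ∀ k, q * (f k * f (k + 2)) ≤ f (k + 1) ^ 2

/-- verbatim copy of `reshape` (ReshapingGenericSketch.lean). -/
def reshape (f : ℕ → ℝ) (P H : ℕ) : Matrix (Fin P) (Fin H) ℝ :=
  Matrix.of fun x y => f (P * (y : ℕ) + (x : ℕ))

/-- verbatim copy of `ReshapingGeneric` (ReshapingGenericSketch.lean) = the card's K1. -/
def ReshapingGeneric : Prop :=
  ∀ q : ℝ, 4 ≤ q → ∀ f : ℕ → ℝ, IsStrongLogConcave q f →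
    ∀ P H : ℕ, (reshape f P H).rank = min P H

/-- **K1 holds.** -/
theorem reshapingGeneric_holds : ReshapingGeneric :=
  fun q hq f hf P H => reshapingGeneric q hq f hf P H

/-- Signed margin hypothesis (critic VERDICT #12 price P1): `f` nowhere zero, `q·|f k|·|f (k+2)| ≤ f (k+1)²`. -/
def IsStrongLogConcaveAbs (q : ℝ) (f : ℕ → ℝ) : Prop :=
  (∀ k, f k ≠ 0) ∧ ∀ k, q * (|f k| * |f (k + 2)|) ≤ f (k + 1) ^ 2

/-- K1 with arbitrary signs: the typed strengthening asked for in P1. -/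
def ReshapingGenericSigned : Prop :=
  ∀ q : ℝ, 4 ≤ q → ∀ f : ℕ → ℝ, IsStrongLogConcaveAbs q f →
    ∀ P H : ℕ, (reshape f P H).rank = min P H

/-- **Signed K1 holds** (same proof: the dominance argument only sees `|f|`). -/
theorem reshapingGenericSigned_holds : ReshapingGenericSigned :=
  fun q hq f hf P H => reshapingGeneric_signed q hq f hf P H

/-- verbatim copy of `hankelCut` (ReshapingGenericSketch.lean). -/
def hankelCut (f : ℕ → ℝ) {ι κ : Type*} (a : ι → ℕ) (b : κ → ℕ) : Matrix ι κ ℝ :=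
  Matrix.of fun i j => f (a i + b j)

/-- verbatim copy of `SpreadHankelGeneric` (ReshapingGenericSketch.lean) = the card's K1′. -/
def SpreadHankelGeneric : Prop :=
  ∀ q : ℝ, 1 < q → ∀ f : ℕ → ℝ, IsStrongLogConcave q f →
    ∀ (r c s : ℕ) (a : Fin r → ℕ) (b : Fin c → ℕ), r ≤ c → StrictMono a → StrictMono b →
      (∀ i j : Fin r, i < j → a i + s ≤ a j) → (∀ i j : Fin c, i < j → b i + s ≤ b j) →
      (4 * r : ℝ) ≤ q ^ (s * s) → (hankelCut f a b).rank = r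

/-- **K1′ holds.** -/
theorem spreadHankelGeneric_holds : SpreadHankelGeneric :=
  fun q hq f hf r c s a b hrc ha hb has hbs hr =>
    spreadHankelGeneric q hq f hf r c s a b hrc ha hb has hbs hr

/-- verbatim copy of `TTSectorLaw` (ReshapingGenericSketch.lean): the typed part of the card's sector law. -/
def TTSectorLaw : Prop := ReshapingGeneric ∧ SpreadHankelGeneric

/-- **The typed sector law holds** (K1 ∧ K1′). -/
theorem ttSectorLaw_holds : TTSectorLaw := ⟨reshapingGeneric_holds, spreadHankelGeneric_holds⟩

section KroneckerCopies
open scoped BigOperators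
open Polynomial

/-- verbatim copy of `digitLift` (ReshapingGenericSketch.lean). -/
noncomputable def digitLift (B n : ℕ) (f : ℕ → ℝ) : MvPolynomial (Fin n) ℝ :=
  ∑ e : Fin n → Fin B, MvPolynomial.C (f (∑ i, (e i : ℕ) * B ^ (i : ℕ))) * ∏ i, MvPolynomial.X i ^ (e i : ℕ)

/-- verbatim copy of `KroneckerDigit` (ReshapingGenericSketch.lean) = the card's support statement P1. -/
def KroneckerDigit : Prop :=
  ∀ (B n c : ℕ) (f : ℕ → ℝ), 2 ≤ B →
    MvPolynomial.aeval (fun i : Fin n => (X : ℝ[X]) ^ (c * B ^ (i : ℕ))) (digitLift B n f)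
      = ∑ k ∈ Finset.range (B ^ n), Polynomial.C (f k) * X ^ (c * k)

/-- **P1 holds.** -/
theorem kroneckerDigit_holds : KroneckerDigit := by
  intro B n c f _
  unfold digitLift
  exact kroneckerDigit_core B n c f

end KroneckerCopies

end K1Check

end Summit.ValiantsHypothesis.ValiantsHypothesis.Cruxes.MatrixDescartes.ReshapingGeneric
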